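import Summits.Schanuel.Schanuel.Theorems.RootDecomp1BProductCell03

/-!
# RootDecomp1BProductCell — lens 4, generation 46 «PRODUCT CELL: TWO INDEPENDENT LIOUVILLE COORDINATES VIA THE QUANTITATIVE STOREY-ONE CELL» (CLAIM L2339, PRICE + CHECKLIST B-g46 L2340, NODE L2399 / REQUEST L2400, critic VERDICT L2407: CLEARED — THEOREM ×1 (K1 twoRadical_lower, the composable quantitative engine) + ONE CELL «RATE-MATCHED PRODUCT 𝒜_W × ℬ_W» (K2 algebraicIndependent_product + cells); RULE B-R33; PORT GO) — continuation (RootDecomp1BProductCell04): §3c threshold bounds incl. the cap lemma thr_le_exp_quartic, §4 the classes, §5 prelude thetaS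

(lens-4 g46 HOME kernel K = HOME/decomp-schanuel-lens-4/g46/ProductCell.lean d6cd9943…, 1931 l, ONE import …RootDecomp1BTwoRadical05; P/C + NODE-g46.md 601195d2…. Port by census-1 gen 20 as `RootDecomp1BProductCell01–08` from the census CAP EDITION ProductCell.capped.lean (K2 `algebraicIndependent_product` is ONE 398-line declaration block > the 400-line file cap: its step (3) «thrP(N) ≤ exp(c_T q⁴)» — four exponential bounds, context-free — is extracted as the public lemma `thr_le_exp_quartic` in §3c with the local abbreviations passed as variables and the defining equation of c_T as a hypothesis; K2's STATEMENT byte-identical, all 87 K decl signatures identical, +1 decl; farm rc 0 · 0/0/0 · axioms std on K2): 01 = §1 Lipschitz (`FrelC`, `lam`, `lipschitz_Frel₂_explicit`) + §2 root avoidance (`fibreSum_ne_zero`); 02 = §3 K1 `thr`, `bigTheta`, `thrP`, **`twoRadical_lower`**; 03 = §3b outer upper half (`norm_normForm_le`, `normForm_len_le`); 04 = §3c `thr_le`, `thr_le_exp_quartic` (cap lemma) + §4 classes `UltraLiouvilleSW` / `TowerLiouville` («[class] definition» tags) + `thr_nonneg` + §5 prelude `thetaS`; 05 = §5 K2 **`algebraicIndependent_product`**;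 06 = §6 law `sw`, members `ultraLiouvilleSW_rhoU` (tree rhoU), `gT`/`vT`/`tTerm`/`rhoT`/`tNum`/`tRat`, `towerLiouville_rhoT`; 07 = §7 cells `algebraicIndependent_eight_of_pos`, `eight_le_polarDeg_one_pair`, `six_le_polarDeg_one_pair`, `schanuel_body_one_pair`, `six_le_polarDeg_pair`, `four_le_polarDeg_pair`, `schanuel_body_pair`, named pair (ρ_U, ρ_T) hyp-free; 08 = §8 `E₅`, `thrP_le_exp`, `transcMeasure_thetaS`, `transcMeasure_rhoU`. PORT EDITS (VERDICT L2407 (a)–(d) + the cap edition): linter option dropped; 26 one-line docstrings added; class tags in the census wording; scoped heartbeats kept `… in` (1600000 ×2, 800000 ×1 as in K); per-part private helper copies; statements and proofs otherwise verbatim (no renames). `--supports stmt-Schanuel-24622`; no census credit carried; rung 0 — nothing here proves Schanuel; no ∀-item moves.)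
-/

noncomputable section
open Complex
namespace Summit.Schanuel.Schanuel.Theorems.RootDecomp1BProductCell
open MvPolynomial
open Summit.Schanuel.Schanuel.Theorems.RootDecomp1KHyper (mvlen mvlen_nonneg one_le_mvlen abs_coeff_le_mvlen)
open RootDecomp1BRadicalDescent (resFin DExpMeasure UltraLiouville exists_int_relation norm_mvaeval_le_mvlen
  totalDegree_det_le mvlen_det_le adjugate_bounds)
open RootDecomp1BTwoRadical (sX₃ sX₃_apply eq_of_parts₃ Cf₂ Frel₂ Frel₂_eq_aeval radMat₂ det_radMat₂_ne_zero
  det_eq_eigen_mul₂ eigen_eq_Frel₂ mvlen_radMat₂_le totalDegree_radMat₂_le mvlen_Cf₂_le twoRadical_clash)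
variable {n : ℕ}

/-- `x^k ≤ exp(k·x)` for `x ≥ 0`. -/
private theorem pow_le_exp_mul {x : ℝ} (hx : 0 ≤ x) (k : ℕ) : x ^ k ≤ Real.exp (k * x) := by
  rw [Real.exp_nat_mul]
  exact pow_le_pow_left₀ hx (by linarith [Real.add_one_le_exp x]) k

/-! ## §3c The threshold is at most single-exponential in the data -/

section ThrBound

/-- **`thr ≤ (A₀ + 19) · Θ · (B+1) · (L·Λ^D) · (δ+2)^{A₀+1}`**, `δ = D + 2BD`: every summand of the threshold is
dominated by the one product (used in §5 to see `thrP(N) ≤ exp(c_T q⁴)` for the norm form `N`). -/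
theorem thr_le (A₀ : ℕ) {Θ Λ : ℝ} (hΘ : 1 ≤ Θ) (hΛ : 1 ≤ Λ) (B D : ℕ) {L : ℤ} (hL : 1 ≤ L) :
    thr A₀ Θ Λ B D L ≤
      ((A₀ : ℝ) + 19) * Θ * ((B : ℝ) + 1) * ((L : ℝ) * Λ ^ D) * (((D + 2 * (B * D) : ℕ) : ℝ) + 2) ^ (A₀ + 1) := by
  have hL1 : (1 : ℝ) ≤ L := by exact_mod_cast hL
  set δ : ℝ := ((D + 2 * (B * D) : ℕ) : ℝ) with hδ
  have hδD : (D : ℝ) ≤ δ := by rw [hδ]; push_cast; nlinarith [Nat.cast_nonneg (α := ℝ) B, Nat.cast_nonneg (α := ℝ) D]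
  have hD0 : (0 : ℝ) ≤ D := Nat.cast_nonneg D
  have hB0 : (0 : ℝ) ≤ B := Nat.cast_nonneg B
  set LΛ : ℝ := (L : ℝ) * Λ ^ D with hLΛ
  have hLΛ1 : 1 ≤ LΛ := by rw [hLΛ]; exact one_le_mul_of_one_le_of_one_le hL1 (one_le_pow₀ hΛ)
  set Pw : ℝ := (δ + 2) ^ (A₀ + 1) with hPw
  have hPw1 : δ + 2 ≤ Pw := by
    rw [hPw]
    calc δ + 2 = (δ + 2) ^ 1 := (pow_one _).symm
      _ ≤ (δ + 2) ^ (A₀ + 1) := pow_le_pow_right₀ (by linarith) (by omega)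
  have hPw1' : (δ + 1) ^ (A₀ + 1) ≤ Pw := by rw [hPw]; exact pow_le_pow_left₀ (by linarith) (by linarith) _
  set S : ℝ := Θ * ((B : ℝ) + 1) * LΛ * Pw with hS
  -- S dominates every atom
  have hS_ge : ∀ {x y z u : ℝ}, 1 ≤ x → x ≤ Θ → 1 ≤ y → y ≤ (B : ℝ) + 1 → 1 ≤ z → z ≤ LΛ → 0 ≤ u → u ≤ Pw →
      x * y * z * u ≤ S := by
    intro x y z u hx hxΘ hy hyB hz hzL hu huP
    rw [hS]
    exact mul_le_mul (mul_le_mul (mul_le_mul hxΘ hyB (by linarith) (by linarith)) hzL (by linarith)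
      (by positivity)) huP hu (by positivity)
  have hB1 : (1 : ℝ) ≤ (B : ℝ) + 1 := by linarith
  have a1 : LΛ ≤ S := by
    have := hS_ge (le_refl 1) hΘ (le_refl 1) hB1 hLΛ1 le_rfl (by linarith) (show (1:ℝ) ≤ Pw by linarith)
    linarith
  have a2 : δ + 2 ≤ S := by
    have := hS_ge (le_refl 1) hΘ (le_refl 1) hB1 (le_refl 1) hLΛ1 (by linarith) hPw1
    linarith
  have a3 : (L : ℝ) ≤ S := by
    have hLle : (L : ℝ) ≤ LΛ := by
      rw [hLΛ]; exact le_mul_of_one_le_right (by linarith) (one_le_pow₀ hΛ)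
    have := hS_ge (le_refl 1) hΘ (le_refl 1) hB1 hL1 hLle (by linarith) (show (1:ℝ) ≤ Pw by linarith)
    linarith
  have a4 : (D : ℝ) * ((B : ℝ) + 1) ≤ S := by
    have := hS_ge (le_refl 1) hΘ hB1 le_rfl (le_refl 1) hLΛ1 (by linarith : (0:ℝ) ≤ δ + 2) hPw1
    nlinarith
  have a5 : Θ * (δ + 2) ≤ S := by
    have := hS_ge hΘ le_rfl (le_refl 1) hB1 (le_refl 1) hLΛ1 (by linarith : (0:ℝ) ≤ δ + 2) hPw1
    linarith
  have a6 : (1 : ℝ) ≤ S := by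
    have := hS_ge (le_refl 1) hΘ (le_refl 1) hB1 (le_refl 1) hLΛ1 (by linarith) (show (1:ℝ) ≤ Pw by linarith)
    linarith
  have a7 : ((A₀ + 1 : ℕ) : ℝ) * (δ + 1) ^ (A₀ + 1) ≤ ((A₀ : ℝ) + 1) * S := by
    have := hS_ge (le_refl 1) hΘ (le_refl 1) hB1 (le_refl 1) hLΛ1 (by positivity) hPw1'
    push_cast
    exact mul_le_mul_of_nonneg_left (by linarith) (by positivity)
  have hfinal : thr A₀ Θ Λ B D L ≤ ((A₀ : ℝ) + 19) * S := by
    unfold thr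
    rw [← hδ, ← hLΛ]
    nlinarith [a1, a2, a3, a4, a5, a6, a7, hδD, hD0]
  calc thr A₀ Θ Λ B D L ≤ ((A₀ : ℝ) + 19) * S := hfinal
    _ = _ := by rw [hS, hPw, hLΛ]; ring

/-- **The threshold of a norm form is at most `exp(c_T · X)`** (census cap edition: the four exponential bounds
of step (3) of `algebraicIndependent_product`, extracted with the local abbreviations passed as variables and
the defining equation of `c_T` as a hypothesis; `X` is the outer scale `q⁴`, `Dn` / `Ln` the degree and the
length of the norm form). -/
theorem thr_le_exp_quartic (A₀ : ℕ) {Θ₀ Λ₀ : ℝ} (hΘ₀1 : 1 ≤ Θ₀) (hΛ₀1 : 1 ≤ Λ₀) (Bσ : ℕ) {Dn : ℕ} {Ln : ℤ}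
    (hLn : 1 ≤ Ln) {X4 cE cT : ℝ} {δe : ℕ} (hq4 : 1 ≤ X4)
    (hNlenR : (Ln : ℝ) ≤ Real.exp ((1 + cE) * X4)) (hDN : (Dn : ℝ) ≤ X4 * δe)
    (hcT : cT = ((A₀ : ℝ) + 19) * Θ₀ * ((Bσ : ℝ) + 1) + (1 + cE) + (δe : ℝ) * Λ₀ +
      ((A₀ : ℝ) + 1) * ((1 + 2 * (Bσ : ℝ)) * δe + 2)) :
    thr A₀ Θ₀ Λ₀ Bσ Dn Ln ≤ Real.exp (cT * X4) := by
  have h0 := thr_le A₀ hΘ₀1 hΛ₀1 Bσ Dn hLn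
  refine le_trans h0 ?_
  have hLn0 : (0 : ℝ) ≤ Ln := by
    have : (1 : ℝ) ≤ Ln := by exact_mod_cast hLn
    linarith
  -- four exponential bounds
  have f1 : ((A₀ : ℝ) + 19) * Θ₀ * ((Bσ : ℝ) + 1) ≤
      Real.exp ((((A₀ : ℝ) + 19) * Θ₀ * ((Bσ : ℝ) + 1)) * X4) := by
    have h1 : ((A₀ : ℝ) + 19) * Θ₀ * ((Bσ : ℝ) + 1) ≤ (((A₀ : ℝ) + 19) * Θ₀ * ((Bσ : ℝ) + 1)) * X4 :=
      le_mul_of_one_le_right (by positivity) hq4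
    linarith [Real.add_one_le_exp ((((A₀ : ℝ) + 19) * Θ₀ * ((Bσ : ℝ) + 1)) * X4)]
  have f2 : (Ln : ℝ) * Λ₀ ^ Dn ≤
      Real.exp ((1 + cE) * X4) * Real.exp (((δe : ℝ) * Λ₀) * X4) := by
    refine mul_le_mul hNlenR ?_ (by positivity) (Real.exp_pos _).le
    refine (pow_le_exp_mul (by linarith) _).trans (Real.exp_le_exp.2 ?_)
    calc (Dn : ℝ) * Λ₀ ≤ (X4 * δe) * Λ₀ := mul_le_mul_of_nonneg_right hDN (by linarith)
      _ = ((δe : ℝ) * Λ₀) * X4 := by ring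
  have f3 : (((Dn + 2 * (Bσ * Dn) : ℕ) : ℝ) + 2) ^ (A₀ + 1) ≤
      Real.exp ((((A₀ : ℝ) + 1) * ((1 + 2 * (Bσ : ℝ)) * δe + 2)) * X4) := by
    refine (pow_le_exp_mul (by positivity) _).trans (Real.exp_le_exp.2 ?_)
    push_cast
    have h1 : (Dn : ℝ) + 2 * ((Bσ : ℝ) * Dn) + 2 ≤ ((1 + 2 * (Bσ : ℝ)) * δe + 2) * X4 := by
      have : (Dn : ℝ) + 2 * ((Bσ : ℝ) * Dn) = (1 + 2 * (Bσ : ℝ)) * Dn := by ring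
      rw [this]
      have h2 : (1 + 2 * (Bσ : ℝ)) * (Dn : ℝ) ≤ (1 + 2 * (Bσ : ℝ)) * (X4 * δe) :=
        mul_le_mul_of_nonneg_left hDN (by positivity)
      nlinarith [h2, hq4, show (0:ℝ) ≤ (1 + 2 * (Bσ : ℝ)) * δe by positivity]
    calc ((A₀ : ℝ) + 1) * ((Dn : ℝ) + 2 * ((Bσ : ℝ) * Dn) + 2)
        ≤ ((A₀ : ℝ) + 1) * (((1 + 2 * (Bσ : ℝ)) * δe + 2) * X4) :=
          mul_le_mul_of_nonneg_left h1 (by positivity)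
      _ = (((A₀ : ℝ) + 1) * ((1 + 2 * (Bσ : ℝ)) * δe + 2)) * X4 := by ring
  have hb0 : (0 : ℝ) ≤ (Ln : ℝ) * Λ₀ ^ Dn := mul_nonneg hLn0 (by positivity)
  calc ((A₀ : ℝ) + 19) * Θ₀ * ((Bσ : ℝ) + 1) * ((Ln : ℝ) * Λ₀ ^ Dn) *
        (((Dn + 2 * (Bσ * Dn) : ℕ) : ℝ) + 2) ^ (A₀ + 1)
      ≤ Real.exp ((((A₀ : ℝ) + 19) * Θ₀ * ((Bσ : ℝ) + 1)) * X4) *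
        (Real.exp ((1 + cE) * X4) * Real.exp (((δe : ℝ) * Λ₀) * X4)) *
        Real.exp ((((A₀ : ℝ) + 1) * ((1 + 2 * (Bσ : ℝ)) * δe + 2)) * X4) :=
        mul_le_mul (mul_le_mul f1 f2 hb0 (Real.exp_pos _).le) f3 (by positivity) (by positivity)
    _ = Real.exp (cT * X4) := by
        simp only [← Real.exp_add]; congr 1; rw [hcT]; ring

end ThrBound

/-! ## §4 [class] The two classes: short waits (`σ`) and out-waiting (`ρ`) -/

section Classes

/-- [class] definition (membership predicate with parameters, NOT a fact; census convention): **`UltraLiouvilleSW W σ` (ultra-Liouville with SHORT WAITS, waiting law `W`).**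
For every height `m`, from some point on EVERY window `[Q, W Q]` contains the denominator of an approximant
`r ≠ σ` with `|σ − r| < exp(−exp((den r)^m))`.  (The tree's `UltraLiouville` asks for one approximant per
height with NO control on where its denominator falls; the quantitative kernel of §3 needs an admissible scale
INSIDE a prescribed window — this is what "short waits" supply.) -/
def UltraLiouvilleSW (W : ℕ → ℕ) (σ : ℝ) : Prop :=
  ∀ m : ℕ, ∃ Q₀ : ℕ, ∀ Q : ℕ, Q₀ ≤ Q → ∃ r : ℚ, Q ≤ r.den ∧ r.den ≤ W Q ∧ σ ≠ r ∧
    |σ - r| < Real.exp (-Real.exp ((r.den : ℝ) ^ m))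

/-- [class] definition (membership predicate with parameters, NOT a fact; census convention): **`TowerLiouville W ρ` (ρ OUT-WAITS the law `W`).**  For every height `m` an
approximant `r ≠ ρ`, `den r ≥ m`, with
`|ρ − r| < exp(−((den r)^m + exp(((W ⌈exp((den r)^m)⌉)²)^m)))` — i.e. `ρ` is approximated at scale `q` to
within the reciprocal of the DOUBLE-EXPONENTIAL TOWER evaluated at the END `W(⌈exp(q^m)⌉)` of the window in which
a `W`-short-waiting `σ` is guaranteed an admissible scale.  RATE-MATCHED to `UltraLiouvilleSW W` through the
defining growth law `W` only (no common denominators, no joint condition on `(σ, ρ)`). -/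
def TowerLiouville (W : ℕ → ℕ) (ρ : ℝ) : Prop :=
  ∀ m : ℕ, ∃ r : ℚ, m ≤ r.den ∧ ρ ≠ r ∧
    |ρ - r| < Real.exp (-(((r.den : ℝ)) ^ m +
      Real.exp (((((W ⌈Real.exp (((r.den : ℝ)) ^ m)⌉₊ : ℕ) : ℝ)) ^ 2) ^ m)))

/-- Short-wait ultra-Liouville reals are ultra-Liouville (tree class `RootDecomp1BRadicalDescent.UltraLiouville`). -/
theorem UltraLiouvilleSW.ultraLiouville {W : ℕ → ℕ} {σ : ℝ} (h : UltraLiouvilleSW W σ) : UltraLiouville σ := by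
  intro m
  obtain ⟨Q₀, hQ₀⟩ := h m
  obtain ⟨r, hQ, -, hne, hlt⟩ := hQ₀ (max Q₀ m) (le_max_left _ _)
  exact ⟨r, (le_max_right _ _).trans hQ, hne, hlt⟩

/-- Out-waiting reals are ultra-Liouville (for a waiting law with `W Q ≥ Q`, e.g. `sw`). -/
theorem TowerLiouville.ultraLiouville {W : ℕ → ℕ} (hW : ∀ Q, Q ≤ W Q) {ρ : ℝ} (h : TowerLiouville W ρ) :
    UltraLiouville ρ := by
  intro m
  obtain ⟨r, hm, hne, hlt⟩ := h m
  refine ⟨r, hm, hne, hlt.trans_le (Real.exp_le_exp.2 (neg_le_neg ?_))⟩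
  rcases Nat.eq_zero_or_pos m with hm0 | hm1
  · subst hm0
    simp only [pow_zero]
    linarith [Real.exp_pos (1 : ℝ)]
  · set x : ℝ := ((r.den : ℝ)) ^ m with hx
    set Q' : ℕ := ⌈Real.exp x⌉₊ with hQ'
    have hx0 : 0 ≤ x := by positivity
    have h1 : Real.exp x ≤ (W Q' : ℝ) := (Nat.le_ceil _).trans (by exact_mod_cast hW Q')
    have hW1 : (1 : ℝ) ≤ (W Q' : ℝ) := le_trans (by linarith [Real.add_one_le_exp x]) h1
    have h2 : (W Q' : ℝ) ≤ ((W Q' : ℝ) ^ 2) ^ m :=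
      calc (W Q' : ℝ) ≤ (W Q' : ℝ) ^ 2 := by nlinarith
        _ ≤ ((W Q' : ℝ) ^ 2) ^ m := le_self_pow₀ (by nlinarith) (by omega)
    have h3 : ((W Q' : ℝ) ^ 2) ^ m ≤ Real.exp (((W Q' : ℝ) ^ 2) ^ m) := by
      linarith [Real.add_one_le_exp (((W Q' : ℝ) ^ 2) ^ m)]
    linarith

/-- A member of `UltraLiouvilleSW W` is irrational. -/
theorem UltraLiouvilleSW.irrational {W : ℕ → ℕ} {σ : ℝ} (h : UltraLiouvilleSW W σ) : Irrational σ :=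
  h.ultraLiouville.irrational

end Classes

/-- The threshold is non-negative. -/
theorem thr_nonneg (A₀ : ℕ) {Θ Λ : ℝ} (hΘ : 0 ≤ Θ) (hΛ : 0 ≤ Λ) (B D : ℕ) {L : ℤ} (hL : 0 ≤ L) :
    0 ≤ thr A₀ Θ Λ B D L := by
  have hL' : (0 : ℝ) ≤ L := by exact_mod_cast hL
  unfold thr; positivity

/-! ## §5 THE PRODUCT KERNEL: all eight of `(e^{ρy₀}, e^{ρy₁}, ρ, e^{σy₀}, e^{σy₁}, σ, θ₀)` -/

section Product

/-- **The transcendental base point of storey two**: `θ_σ = (e^{σ y₀}, e^{σ y₁}, σ, θ₀)`. -/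
def thetaS (θ₀ : Fin n → ℂ) (y₀ y₁ : ℂ) (σ : ℝ) : Fin (n + 3) → ℂ :=
  Fin.cons (cexp ((σ : ℂ) * y₀)) (Fin.cons (cexp ((σ : ℂ) * y₁)) (Fin.cons (σ : ℂ) θ₀))

/-- Evaluation at `θ_σ` is the relation value `Frel₂`. -/
theorem aeval_thetaS (θ₀ : Fin n → ℂ) (y₀ y₁ : ℂ) (σ : ℝ) (N : MvPolynomial (Fin (n + 3)) ℤ) :
    aeval (thetaS θ₀ y₀ y₁ σ) N = Frel₂ N θ₀ y₀ y₁ σ := (Frel₂_eq_aeval N θ₀ y₀ y₁ σ).symm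

/-- The tail coordinates of `θ_σ` are `θ₀`. -/
theorem thetaS_succ_succ_succ (θ₀ : Fin n → ℂ) (y₀ y₁ : ℂ) (σ : ℝ) (i : Fin n) :
    thetaS θ₀ y₀ y₁ σ i.succ.succ.succ = θ₀ i := by simp [thetaS]

/-- `a + exp b ≤ exp (a + b)` for `a, b ≥ 0`. -/
private theorem add_exp_le_exp_add {a b : ℝ} (ha : 0 ≤ a) (hb : 0 ≤ b) : a + Real.exp b ≤ Real.exp (a + b) := by
  rw [Real.exp_add]
  have h1 : a + 1 ≤ Real.exp a := Real.add_one_le_exp a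
  have h2 : 1 ≤ Real.exp b := Real.one_le_exp hb
  nlinarith [Real.exp_pos a, Real.exp_pos b]

end Product

end Summit.Schanuel.Schanuel.Theorems.RootDecomp1BProductCell

end
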